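import Literature.Probability.LatticeModels.DartPhase
import Literature.Probability.LatticeModels.DirichletGreenFunction
import Literature.Probability.RandomPlanarGeometry.PlanarDomains
import Literature.Probability.Percolation.BoxCrossingProofs
import Summits.CriticalPhenomena.CardyFormulaZ2.Theorems.CardySusyWardParafermionPrecompactKenyonDefs

/-!
# Touch-profile bookkeeping and the trivial bound (helper for stub `stub_touchProfileLaws`)

Line `kenyon-stream-second-relation` of the crux `ParafermionPrecompact` (route `CardySusyWard`,
item stmt-CriticalPhenomena-11293), vocabulary of `…KenyonDefs`. Deterministic / measure-trivial
facts about the quantities of STUB 5 (`stub_touchProfileLaws`), recorded to make precise WHAT the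
stub needs from percolation beyond them.

* `touchProb E z r ∈ [0, 1]` and is monotone under inclusion of the closed balls
  (`touchProb_nonneg`, `touchProb_le_one`, `touchProb_mono`); `edgeDepth E p ≥ E.δ`,
  `0 ≤ defectProfile E pz p ≤ (E.δ / edgeDepth E p) ^ pz ≤ 1` for `E.δ > 0`, `pz ≥ 0`.
* THE BOUNDARY LAYER: a site `w` of the outer boundary `∂Λ_δ` of the `6δ`-deep sites
  `Λ_δ = deepSites D δ` has `closedBall (δw) (5δ) ⊆ D` and `closedBall (δw) (6δ) ⊄ D`
  (`layer_of_mem_outerBoundary_deepSites`), hence `5δ ≤ dist(δw, Dᶜ) ≤ 6δ`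
  (`infDist_of_mem_outerBoundary_deepSites`): `∂Λ_δ` is the lattice annulus at distance `(5δ, 6δ]`
  from `∂D`.
* THE TRIVIAL BOUND (`poissonTouch_le_of_layer_bound`, registered helper): since
  `Σ_{w ∈ ∂Λ} H_Λ(x₀, w) = 1` (`sum_poissonKernel`, Lawler 1991 §1.4) and `H_Λ ≥ 0`, the Poisson
  average of clause (i-b) of STUB 5 is at most the supremum of `touchProb (Λ δ) (δw) δ` over the
  layer, in particular `≤ 1` (`poissonTouch_le_one`), and the pair sum of clause (ii-b) is `≤ 2`
  (`pairPoissonTouch_le_two`). This is exactly what is MISSING for the stub: the layer supremum is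
  `O(1)` near the marks `a, b` (the interface starts there) and the gain `δ^{1/3}` is only available on
  AVERAGE against harmonic measure (the boundary one-arm exponent `1/3` of critical percolation;
  inputs isolated as named statements in `…TouchProfileDefs`).

References: G. F. Lawler, *Intersections of Random Walks* (1991), §1.4 [Lawler1991]. Elementary,
tagged `[folklore]`.
-/

noncomputable section

namespace Summit.CriticalPhenomena.CardyFormulaZ2.Cruxes.ParafermionPrecompact.KenyonStreamSecondRelation

open scoped BigOperators Topology
open Filter Set MeasureTheory
open _root_.Literature.Probability.LatticeModels
open _root_.Literature.Probability.RandomPlanarGeometry (DobrushinDomain)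
open _root_.Literature.Probability.Percolation (BondConfig bondPercolation half)

/-! ### `touchProb`, `edgeDepth`, `defectProfile` -/

/-- A touch probability is nonnegative. [folklore] -/
theorem touchProb_nonneg (E : DiscreteDobrushin) (z : ℂ) (r : ℝ) : 0 ≤ touchProb E z r :=
  measureReal_nonneg

/-- A touch probability is at most `1`. [folklore] -/
theorem touchProb_le_one (E : DiscreteDobrushin) (z : ℂ) (r : ℝ) : touchProb E z r ≤ 1 :=
  measureReal_le_one

/-- Touch probabilities are monotone under inclusion of the closed balls. [folklore] -/
theorem touchProb_mono (E : DiscreteDobrushin) {z z' : ℂ} {r r' : ℝ}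
    (h : Metric.closedBall z r ⊆ Metric.closedBall z' r') :
    touchProb E z r ≤ touchProb E z' r' := by
  unfold touchProb
  refine measureReal_mono (fun ω hω => ?_) (measure_ne_top _ _)
  obtain ⟨e, he, hd⟩ := hω
  exact ⟨e, he, Metric.mem_closedBall.1 (h (Metric.mem_closedBall.2 hd))⟩

/-- In particular they are monotone in the radius. [folklore] -/
theorem touchProb_mono_radius (E : DiscreteDobrushin) (z : ℂ) {r r' : ℝ} (h : r ≤ r') :
    touchProb E z r ≤ touchProb E z r' :=
  touchProb_mono E (Metric.closedBall_subset_closedBall h)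

/-- The depth of an edge is at least one mesh. [folklore] -/
theorem delta_le_edgeDepth (E : DiscreteDobrushin) (p : Site 2 × Fin 2) : E.δ ≤ edgeDepth E p :=
  le_max_right _ _

/-- The depth of an edge is at least the distance of its midpoint to the complement. [folklore] -/
theorem infDist_le_edgeDepth (E : DiscreteDobrushin) (p : Site 2 × Fin 2) :
    Metric.infDist (medialPoint E.δ (mv p)) E.Ωᶜ ≤ edgeDepth E p :=
  le_max_left _ _

/-- For a positive mesh the depth is positive. [folklore] -/
theorem edgeDepth_pos {E : DiscreteDobrushin} (hE : 0 < E.δ) (p : Site 2 × Fin 2) :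
    0 < edgeDepth E p :=
  hE.trans_le (delta_le_edgeDepth E p)

/-- For a positive mesh, `0 < E.δ / edgeDepth E p ≤ 1`. [folklore] -/
theorem div_edgeDepth_mem_Ioc {E : DiscreteDobrushin} (hE : 0 < E.δ) (p : Site 2 × Fin 2) :
    0 < E.δ / edgeDepth E p ∧ E.δ / edgeDepth E p ≤ 1 :=
  ⟨div_pos hE (edgeDepth_pos hE p), div_le_one_of_le₀ (delta_le_edgeDepth E p) (edgeDepth_pos hE p).le⟩

/-- The defect profile is nonnegative (positive mesh). [folklore] -/
theorem defectProfile_nonneg {E : DiscreteDobrushin} (hE : 0 < E.δ) (pz : ℝ) (p : Site 2 × Fin 2) :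
    0 ≤ defectProfile E pz p :=
  mul_nonneg (Real.rpow_nonneg (div_edgeDepth_mem_Ioc hE p).1.le _) (touchProb_nonneg _ _ _)

/-- The defect profile is at most its scale factor `(δ / depth)^{pz}`. [folklore] -/
theorem defectProfile_le_rpow {E : DiscreteDobrushin} (hE : 0 < E.δ) (pz : ℝ) (p : Site 2 × Fin 2) :
    defectProfile E pz p ≤ (E.δ / edgeDepth E p) ^ pz := by
  unfold defectProfile
  exact mul_le_of_le_one_right (Real.rpow_nonneg (div_edgeDepth_mem_Ioc hE p).1.le _)
    (touchProb_le_one _ _ _)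

/-- The defect profile is at most `1` for a nonnegative exponent. [folklore] -/
theorem defectProfile_le_one {E : DiscreteDobrushin} (hE : 0 < E.δ) {pz : ℝ} (hpz : 0 ≤ pz)
    (p : Site 2 × Fin 2) : defectProfile E pz p ≤ 1 :=
  (defectProfile_le_rpow hE pz p).trans
    (Real.rpow_le_one (div_edgeDepth_mem_Ioc hE p).1.le (div_edgeDepth_mem_Ioc hE p).2 hpz)

/-! ### The boundary layer `∂Λ_δ` of the deep sites -/

/-- THE LAYER: a site of the outer boundary of the `6δ`-deep sites is `5δ`-deep but not `6δ`-deep.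
[folklore] -/
theorem layer_of_mem_outerBoundary_deepSites (D : DobrushinDomain) {δ : ℝ} (hδ : 0 < δ)
    {w : Site 2} (hw : w ∈ outerBoundary (zdGraph 2) (deepSites D δ)) :
    Metric.closedBall (meshPoint δ w) (5 * δ) ⊆ D.carrier ∧
      ¬ Metric.closedBall (meshPoint δ w) (6 * δ) ⊆ D.carrier := by
  obtain ⟨hw₁, y, hy, hadj⟩ := mem_outerBoundary_iff.1 hw
  refine ⟨fun z hz => (mem_deepSites D hδ).1 hy ?_, fun h => hw₁ ((mem_deepSites D hδ).2 h)⟩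
  rw [Metric.mem_closedBall] at hz ⊢
  calc dist z (meshPoint δ y) ≤ dist z (meshPoint δ w) + dist (meshPoint δ w) (meshPoint δ y) :=
        dist_triangle _ _ _
    _ ≤ 5 * δ + |δ| :=
        add_le_add hz (Literature.Probability.Percolation.dist_meshPoint_of_adj hadj).le
    _ = 6 * δ := by rw [abs_of_pos hδ]; ring

/-- Hence the layer lies at distance between `5δ` and `6δ` from the complement of the domain.
[folklore] -/
theorem infDist_of_mem_outerBoundary_deepSites (D : DobrushinDomain) {δ : ℝ} (hδ : 0 < δ)
    {w : Site 2} (hw : w ∈ outerBoundary (zdGraph 2) (deepSites D δ)) :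
    5 * δ ≤ Metric.infDist (meshPoint δ w) D.carrierᶜ ∧
      Metric.infDist (meshPoint δ w) D.carrierᶜ ≤ 6 * δ := by
  obtain ⟨h5, h6⟩ := layer_of_mem_outerBoundary_deepSites D hδ hw
  have hne : (D.carrierᶜ : Set ℂ).Nonempty := Set.nonempty_compl.2 D.carrier_ne_univ
  refine ⟨(Metric.le_infDist hne).2 fun z hz => ?_, ?_⟩
  · by_contra hlt
    exact hz (h5 (Metric.mem_closedBall.2 (by rw [dist_comm]; exact (not_le.1 hlt).le)))
  · obtain ⟨z, hz, hzD⟩ := Set.not_subset.1 h6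
    calc Metric.infDist (meshPoint δ w) D.carrierᶜ ≤ dist (meshPoint δ w) z :=
          Metric.infDist_le_dist_of_mem hzD
      _ ≤ 6 * δ := by rw [dist_comm]; exact Metric.mem_closedBall.1 hz

/-- A layer site lies in the domain. [folklore] -/
theorem meshPoint_mem_of_mem_outerBoundary_deepSites (D : DobrushinDomain) {δ : ℝ} (hδ : 0 < δ)
    {w : Site 2} (hw : w ∈ outerBoundary (zdGraph 2) (deepSites D δ)) :
    meshPoint δ w ∈ D.carrier :=
  (layer_of_mem_outerBoundary_deepSites D hδ hw).1 (Metric.mem_closedBall_self (by positivity))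

/-! ### Poisson averages: the trivial bounds -/

/-- A Poisson average over `∂Λ` of a function bounded by `M` on `∂Λ` is at most `M` (`x₀ ∈ Λ`;
`Σ_w H_Λ(x₀,w) = 1`, `H_Λ ≥ 0`). [folklore] -/
theorem sum_poissonKernel_mul_le {Λ : Finset (Site 2)} {x₀ : Site 2} (hx₀ : x₀ ∈ Λ)
    {f : Site 2 → ℝ} {M : ℝ} (hf : ∀ w ∈ outerBoundary (zdGraph 2) Λ, f w ≤ M) :
    (∑ w ∈ outerBoundary (zdGraph 2) Λ,
        Literature.Probability.LatticeModels.poissonKernel Λ x₀ w * f w) ≤ M := by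
  calc (∑ w ∈ outerBoundary (zdGraph 2) Λ, poissonKernel Λ x₀ w * f w)
      ≤ ∑ w ∈ outerBoundary (zdGraph 2) Λ, poissonKernel Λ x₀ w * M :=
        Finset.sum_le_sum fun w hw =>
          mul_le_mul_of_nonneg_left (hf w hw) (poissonKernel_nonneg (by norm_num) _ _ _)
    _ = M := by rw [← Finset.sum_mul, sum_poissonKernel (by norm_num) Λ hx₀, one_mul]

/-- … and at least `m` if the function is at least `m` on `∂Λ`. [folklore] -/
theorem le_sum_poissonKernel_mul {Λ : Finset (Site 2)} {x₀ : Site 2} (hx₀ : x₀ ∈ Λ)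
    {f : Site 2 → ℝ} {m : ℝ} (hf : ∀ w ∈ outerBoundary (zdGraph 2) Λ, m ≤ f w) :
    m ≤ ∑ w ∈ outerBoundary (zdGraph 2) Λ,
        Literature.Probability.LatticeModels.poissonKernel Λ x₀ w * f w := by
  calc m = ∑ w ∈ outerBoundary (zdGraph 2) Λ, poissonKernel Λ x₀ w * m := by
        rw [← Finset.sum_mul, sum_poissonKernel (by norm_num) Λ hx₀, one_mul]
    _ ≤ ∑ w ∈ outerBoundary (zdGraph 2) Λ, poissonKernel Λ x₀ w * f w :=
        Finset.sum_le_sum fun w hw =>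
          mul_le_mul_of_nonneg_left (hf w hw) (poissonKernel_nonneg (by norm_num) _ _ _)

/-- **The trivial bound** (registered helper for `stub_touchProfileLaws`). If the touch probability
at scale `δ` is bounded by `M` on the lattice layer at distance `[5δ, 6δ]` from `∂D`, then the
Poisson average of clause (i-b) of STUB 5 is at most `M`, at every deep site `x₀`. What the stub
asserts instead is the bound `C δ^{1/3}` for the AVERAGE, which does not follow from any layer
supremum (the supremum is `O(1)` near the marks). [folklore] -/
theorem poissonTouch_le_of_layer_bound :
    ∀ (D : DobrushinDomain) (E : DiscreteDobrushin) (δ M : ℝ), 0 < δ →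
      (∀ w : Site 2, 5 * δ ≤ Metric.infDist (meshPoint δ w) D.carrierᶜ →
          Metric.infDist (meshPoint δ w) D.carrierᶜ ≤ 6 * δ → touchProb E (meshPoint δ w) δ ≤ M) →
      ∀ x₀ ∈ deepSites D δ,
        (∑ w ∈ outerBoundary (zdGraph 2) (deepSites D δ),
            Literature.Probability.LatticeModels.poissonKernel (deepSites D δ) x₀ w *
              touchProb E (meshPoint δ w) δ) ≤ M := by
  intro D E δ M hδ hM x₀ hx₀
  refine sum_poissonKernel_mul_le hx₀ fun w hw => ?_
  obtain ⟨h5, h6⟩ := infDist_of_mem_outerBoundary_deepSites D hδ hw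
  exact hM w h5 h6

/-- In particular the Poisson average of clause (i-b) lies in `[0, 1]`. [folklore] -/
theorem poissonTouch_mem_Icc (D : DobrushinDomain) (E : DiscreteDobrushin) {δ : ℝ}
    {x₀ : Site 2} (hx₀ : x₀ ∈ deepSites D δ) (r : ℝ) :
    0 ≤ (∑ w ∈ outerBoundary (zdGraph 2) (deepSites D δ),
        Literature.Probability.LatticeModels.poissonKernel (deepSites D δ) x₀ w *
          touchProb E (meshPoint δ w) r) ∧
      (∑ w ∈ outerBoundary (zdGraph 2) (deepSites D δ),
        Literature.Probability.LatticeModels.poissonKernel (deepSites D δ) x₀ w *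
          touchProb E (meshPoint δ w) r) ≤ 1 :=
  ⟨le_sum_poissonKernel_mul hx₀ fun _ _ => touchProb_nonneg _ _ _,
    sum_poissonKernel_mul_le hx₀ fun _ _ => touchProb_le_one _ _ _⟩

/-- The pair sum of clause (ii-b) is trivially at most `2`. [folklore] -/
theorem pairPoissonTouch_le_two (D : DobrushinDomain) (E : DiscreteDobrushin) {δ : ℝ}
    {x₀ x₁ : Site 2} (hx₀ : x₀ ∈ deepSites D δ) (hx₁ : x₁ ∈ deepSites D δ) (r : ℝ) :
    (∑ w ∈ outerBoundary (zdGraph 2) (deepSites D δ),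
        |Literature.Probability.LatticeModels.poissonKernel (deepSites D δ) x₀ w -
            Literature.Probability.LatticeModels.poissonKernel (deepSites D δ) x₁ w| *
          touchProb E (meshPoint δ w) r) ≤ 2 := by
  have hH := fun x w => poissonKernel_nonneg (d := 2) (by norm_num) (deepSites D δ) x w
  calc (∑ w ∈ outerBoundary (zdGraph 2) (deepSites D δ),
        |poissonKernel (deepSites D δ) x₀ w - poissonKernel (deepSites D δ) x₁ w| *
          touchProb E (meshPoint δ w) r)
      ≤ ∑ w ∈ outerBoundary (zdGraph 2) (deepSites D δ),
          (poissonKernel (deepSites D δ) x₀ w * 1 + poissonKernel (deepSites D δ) x₁ w * 1) := by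
        refine Finset.sum_le_sum fun w _ => ?_
        have hab : |poissonKernel (deepSites D δ) x₀ w - poissonKernel (deepSites D δ) x₁ w| ≤
            poissonKernel (deepSites D δ) x₀ w + poissonKernel (deepSites D δ) x₁ w := by
          rw [abs_sub_le_iff]; constructor <;> linarith [hH x₀ w, hH x₁ w]
        calc _ ≤ (poissonKernel (deepSites D δ) x₀ w + poissonKernel (deepSites D δ) x₁ w) * 1 :=
              mul_le_mul hab (touchProb_le_one _ _ _) (touchProb_nonneg _ _ _)
                (add_nonneg (hH x₀ w) (hH x₁ w))
          _ = _ := by ring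
    _ = 2 := by
        rw [Finset.sum_add_distrib, ← Finset.sum_mul, ← Finset.sum_mul,
          sum_poissonKernel (by norm_num) _ hx₀, sum_poissonKernel (by norm_num) _ hx₁]
        norm_num

end Summit.CriticalPhenomena.CardyFormulaZ2.Cruxes.ParafermionPrecompact.KenyonStreamSecondRelation

end
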